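import Literature.MathematicalPhysics.QuantumFieldTheory.Balaban1983to89.B3Ineq25SmoothLocalization
import Literature.MathematicalPhysics.QuantumFieldTheory.Balaban1983to89.B4PartitionUnity22

/-!
# `Balaban1983to89.B3SmoothLocalization420` — [Balaban1983Higgs3] p. 420: THE SMOOTH LOCALIZATION FUNCTIONS
# (the vector-leg smooth partition of unity with supports in cubes of side 2, and the external-field bumps `h = 1` on `□(v)`)
# CONSTRUCTED on the `(Higgs)₂,₃` torus carrier and PROVED to lie in the class `IsSmoothLoc` of `…B3Ineq31SmoothLocalization`

statement-level skeleton of published theorems with citation tags; proofs where landed; nothing here is a claim about the Yang–Mills mass gap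

CITATION HEADER (lean-in-tree rule).  T. Bałaban, *(Higgs)₂,₃ quantum fields in a finite volume. III. Renormalization*, Commun. Math.
Phys. **88** (1983) 411–445, doi:10.1007/bf01213217 [Balaban1983Higgs3] (cell paper B3; held text
`paper:balaban1983-higgs-2-3-quantum-fields-finite-volume`, journal page = PDF page + 410; p. 420 = `p0010.txt`, re-read by this seat).
Phase-2 file of the `lit-balaban` typed skeleton (HOME `run/shared/lean/pub/lit-balaban/`), seat **p33 gen 62** (free target under G.5-34(d),
TAKING 2026-08-23T03:05Z); SKELETON row **B3.Def@420** (the p. 420 localizations; owner r15) — a CONSTRUCTED member next to the tent/Lipschitz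
profiles of `…B3IBPZeroBoxVertices` (p19) —, and the non-vacuity of the smooth-localization members of rows **B3.Eq3.1** (`…B3Ineq31SmoothLocalization`,
p40 g69, the lead's Q6 condition) and **B3.Eq2.5** (`…B3Ineq25SmoothLocalization`, p33 g61, the lead's Q7 condition (ii)), both of which quantify
over the class `IsSmoothLoc k c₁ c₂ α S h`, of which no inhabitant had been constructed in the tree (the zero function is one trivially).

WHAT IS PRINTED (p. 420, verbatim from the held text layer).  *«The next thing we need is a further localization in the vertices. For the
vertices (1.6) and (1.7) we localize simply by representing Ω₁ as a sum of unit cubes of the η-lattice. For the remaining vertices we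
localize, taking for each leg of the vector field a smooth partition of unity satisfying the condition that a support of each function is
contained in a cube with sides of length 2.»* and, after (1.33): *«the functions h_v, h′_v describes localizations of external fields. More
exactly if in a vertex v there is a leg of external field, then we multiply it by a smooth function h such that h = 1 on □(v) and h = 0
outside some neighborhood of □(v)»*.  Print fixes no profile and no constants.

WHAT THIS MODULE CONSTRUCTS AND PROVES (all `theorem`s sorry-free, no `Prop`-valued fact, axioms standard).  Units: `T_ε` = the level-0
torus `HiggsLattice.Site P 0`; after `k` steps the `η`-lattice unit cube has `L^k` fine sites a side; a *corner* `c : Site` and the relative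
label `(x_μ − c_μ).val ∈ [0, |T_ε|_μ)` (periodic), the relative coordinate `relC k c x μ = (x_μ − c_μ).val / L^k` in `η`-units.
* §1 real variable: the MIXED second-difference bound `|(g(t+η) − g(t)) − (g(t′+η) − g(t′))| ≤ sup|g″|·|η|·|t − t′|` (`abs_mixed_diff_le_D2`,
  mean value twice, r01's `D2`); the two concrete profiles built from r01's `C₀^∞` plateau profile `hprof` of `…B4PartitionUnity22`
  (`= 1` on `|t| ≤ 3/8`, `= 0` off `|t| < 5/8`, `Σ_{n∈ℤ} hprof(t − n)² = 1`): the side-2 partition profile `prof2 t = hprof(t − 1)²`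
  (support in `]3/8, 13/8[`) and the side-3 bump profile `prof3 t = hprof(3t/4 − 9/8)` (`= 1` on `[1, 2]`, support in `]2/3, 7/3[`); the
  class `IsProfile m g` (C^∞, compact support, `|g| ≤ 1`, support in `]1/4, m − 1/4[`) and `isProfile_prof2 : IsProfile 2 prof2`,
  `isProfile_prof3 : IsProfile 3 prof3`.
* §2 the telescoping bound for finite products `|∏ aᵢ − ∏ bᵢ| ≤ Σᵢ |aᵢ − bᵢ|·∏_{j≠i} Mⱼ` (`abs_prod_sub_prod_le`, private folklore).
* §3 torus calculus: values of `(w ± 1).val` on `ZMod n`; `relC` under `shift`/`unshift`; the periodic box `pboxSet k c m = {x : (x_μ − c_μ).val < mL^k ∀μ}`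
  and its identification `pboxSet k c m = boxSet k (c/L^k) m` with p40's box when the corner is cube-aligned and the box does not wrap
  (`pboxSet_eq_boxSet`); the CIRCULAR Lipschitz lemma `abs_sub_le_mul_val` (a `K`-Lipschitz `F` vanishing at `0` and at the period `n` satisfies
  `|F(a.val) − F(b.val)| ≤ K·(a − b).val` on `ZMod n`, hence `≤ K·` torus distance).
* §4 **the generic bump `bump g k c x = ∏_μ g(relC k c x μ)` is a smooth localization function**: for every profile `IsProfile m g`, every `k`
  with `4 ≤ L^k`, every corner `c` and `mL^k ≤ |T_ε|_μ`:  `dEta k (bump g k c) ⟨x, μ⟩ = L^k(g(t_μ + L^{−k}) − g(t_μ))·∏_{ν≠μ} g(t_ν)` exactly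
  (`dEta_bump`, the wrap-around bond included), and **`isSmoothLoc_bump : IsSmoothLoc k (D1 g) (d·(D2 g + (D1 g)²)) 1 (pboxSet k c m) (bump g k c)`**
  — `|h| ≤ 1`, `|∂^ηh| ≤ sup|g′|`, `∂^η_μh` Lipschitz in the torus distance with constant `d(sup|g″| + sup|g′|²)`, support with collar in the
  periodic side-`m` box —; every exponent `0 ≤ α ≤ 1` by p33 g61's `isSmoothLoc_of_lip` (`isSmoothLoc_bump_rpow`).
* §5 **the p. 420 objects**: (a) the EXTERNAL-FIELD BUMP `theta k c = bump prof3 k c`: `= 1` on the unit cube `□(v)`, `v = c + L^k·𝟙`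
  (`theta_eq_one`), a member of `IsSmoothLoc k c₁θ c₂θ 1 (pboxSet k c 3)` (`isSmoothLoc_theta`; in p40's box form `isSmoothLoc_theta_boxSet`);
  (b) the VECTOR-LEG PARTITION OF UNITY `chi k c = bump prof2 k c` over the cube-aligned corners `corners k` (`L^k ∣ c_μ`): each member in
  `IsSmoothLoc k c₁χ c₂χ 1 (pboxSet k c 2)` (`isSmoothLoc_chi`, box form `isSmoothLoc_chi_boxSet`) and **`sum_chi : Σ_{c ∈ corners k} chi k c x = 1`
  at every site of `T_ε`** (the one-variable periodic identity `sum_prof2_periodic` from r01's `sum_hprof_sq`, then `Finset.prod_univ_sum`);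
  (c) inhabitants of p33 g61's carrier: `smoothLocFnOfBump : SmoothLocFn k K₀ Ω₂ r₀ m (D1 g) (d(D2 g + (D1 g)²))` for the product bump of
  any side-`m` profile on a box of admissible cubes (`θ_c`: `m = 3`, `χ_c`: `m = 2`), and `theta_corner_shift_eq_one` (the bump is not `0`).
  The constants `c₁θ = D1 prof3`, `c₂θ d = d(D2 prof3 + (D1 prof3)²)` (and `χ` alike) are ABSOLUTE (depend on `d` only; existence via r01's
  `D1`/`D2`, not numerals — print fixes none).

HONEST SCOPE.  (i) The profiles are ONE admissible choice (print: «a smooth partition of unity», «a smooth function h»); the partition members are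
squares of r01's [Balaban1983RegularityDecay] p. 575 profile so that `Σ = 1` (not `Σ h² = 1`) holds exactly, each supported with its lattice collar
in a cube of side 2 (support length `5/4 < 2`); the bump is `= 1` on `□(v)` and vanishes outside the ring of adjacent cubes (side-3 box), which is
«some neighborhood of □(v)».  (ii) `4 ≤ L^k` (one fine step `≤ 1/4` in `η`-units) keeps the collar inside the box; `k ≤ K` makes the unit cubes
tile the torus.  (iii) Members of the partition whose side-2 box straddles the coordinate seam of `T_ε` are in the class with the PERIODIC box
`pboxSet` as support; p40's `boxSet` form is given for the non-wrapping ones (`c_μ + mL^k ≤ |T_ε|_μ`) — the torus is translation invariant and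
the seam is a coordinate artefact; translating a given pair of boxes off the seam is left to the consumer.  (iv) Nothing of (1.33)/(2.5)/(3.1) is asserted here; no head claim.  Unit `lit-balaban-p33` gen 62, 2026-08-23.
-/

noncomputable section

open scoped BigOperators ContDiff Topology
open Finset

namespace Literature.MathematicalPhysics.QuantumFieldTheory.Balaban1983to89.B3SmoothLocalization420

open B3Ineq31SmoothLocalization (InBox boxSet mem_boxSet dEta IsSmoothLoc)
open B3Norm132SmoothMultiplier (isSmoothLoc_of_lip)
open B3Ineq25SmoothLocalization (SmoothLocFn DomD domD_of_box)
open B3Ineq210RegularRegion (Interior)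
open B1Ineq234Concrete (distC)
open B1Ineq234LevelZero (tdist_comm)
open B1TorusChainTransport (shift_apply_self shift_apply_ne)
open B4PartitionUnity22 (hprof hprof_nonneg hprof_le_one hprof_eq_one hprof_eq_zero contDiff_hprof hasCompactSupport_hprof
  D1 D2 D1_nonneg D2_nonneg abs_sub_le_D1 abs_deriv2_le_D2 sum_hprof_sq)

variable {P : HiggsLattice.Params}

/-! ## §1 Real-variable facts: the mixed second difference, the profiles -/

section RealVar

/-- **the mixed second difference of a `C₀^∞` function**: `|(g(t+η) − g(t)) − (g(t′+η) − g(t′))| ≤ sup|g″|·|η|·|t − t′|` (mean value theorem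
twice) — the real-variable content of «`∂^ηh` is Hölder/Lipschitz» in the (1.32) norm of a smooth localization function.
[cite: Balaban1983Higgs3, (1.32) p.420] -/
theorem abs_mixed_diff_le_D2 {g : ℝ → ℝ} (hg : ContDiff ℝ ∞ g) (hs : HasCompactSupport g) (t t' η : ℝ) :
    |(g (t + η) - g t) - (g (t' + η) - g t')| ≤ D2 g * |η| * |t - t'| := by
  have hdiff : Differentiable ℝ g := hg.differentiable (by simp)
  have hdiff' : Differentiable ℝ (deriv g) := (contDiff_infty_iff_deriv.mp hg).2.differentiable (by simp)
  have hφ : ∀ u, HasDerivAt (fun u => g (u + η) - g u) (deriv g (u + η) - deriv g u) u := fun u =>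
    ((hdiff (u + η)).hasDerivAt.comp_add_const u η).sub (hdiff u).hasDerivAt
  have hφb : ∀ u, |deriv (fun u => g (u + η) - g u) u| ≤ D2 g * |η| := by
    intro u
    rw [(hφ u).deriv]
    have h := Convex.norm_image_sub_le_of_norm_deriv_le (f := deriv g) (s := Set.univ)
      (fun x _ => hdiff' x) (fun x _ => by rw [Real.norm_eq_abs]; exact abs_deriv2_le_D2 hg hs x)
      convex_univ (Set.mem_univ u) (Set.mem_univ (u + η))
    simpa only [Real.norm_eq_abs, add_sub_cancel_left] using h
  have key := Convex.norm_image_sub_le_of_norm_deriv_le (f := fun u => g (u + η) - g u) (s := Set.univ)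
    (fun x _ => (hφ x).differentiableAt) (fun x _ => by rw [Real.norm_eq_abs]; exact hφb x)
    convex_univ (Set.mem_univ t') (Set.mem_univ t)
  simpa only [Real.norm_eq_abs] using key

/-- **an admissible side-`m` profile** (what the lattice construction uses of a one-variable bump): `C^∞`, compactly supported, `|g| ≤ 1`,
and `g(t) ≠ 0 ⇒ 1/4 < t < m − 1/4` (room for the lattice collar inside `[0, m]` once a fine step is `≤ 1/4`).
[cite: Balaban1983Higgs3, p.420] -/
structure IsProfile (m : ℕ) (g : ℝ → ℝ) : Prop where
  smooth : ContDiff ℝ ∞ g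
  cpt : HasCompactSupport g
  abs_le : ∀ t, |g t| ≤ 1
  supp : ∀ t, g t ≠ 0 → 1 / 4 < t ∧ t < m - 1 / 4

namespace IsProfile

variable {m : ℕ} {g : ℝ → ℝ}

/-- a profile vanishes at arguments `≤ 1/4`. [cite: Balaban1983Higgs3, p.420] -/
theorem eq_zero_of_le (hg : IsProfile m g) {t : ℝ} (ht : t ≤ 1 / 4) : g t = 0 := by
  by_contra h; exact absurd (hg.supp t h).1 (not_lt.2 ht)

/-- a profile vanishes at arguments `≥ m − 1/4`. [cite: Balaban1983Higgs3, p.420] -/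
theorem eq_zero_of_ge (hg : IsProfile m g) {t : ℝ} (ht : (m : ℝ) - 1 / 4 ≤ t) : g t = 0 := by
  by_contra h; exact absurd (hg.supp t h).2 (not_lt.2 ht)

/-- Lipschitz bound of a profile: `|g(s) − g(s′)| ≤ sup|g′|·|s − s′|`. [cite: Balaban1983Higgs3, (1.32) p.420] -/
theorem lip (hg : IsProfile m g) (s s' : ℝ) : |g s - g s'| ≤ D1 g * |s - s'| :=
  abs_sub_le_D1 hg.smooth hg.cpt s' s

/-- `0 ≤ sup|g′|`. [cite: Balaban1983Higgs3, (1.32) p.420] -/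
theorem D1_nonneg (hg : IsProfile m g) : 0 ≤ D1 g := B4PartitionUnity22.D1_nonneg hg.smooth hg.cpt

/-- `0 ≤ sup|g″|`. [cite: Balaban1983Higgs3, (1.32) p.420] -/
theorem D2_nonneg (hg : IsProfile m g) : 0 ≤ D2 g := B4PartitionUnity22.D2_nonneg hg.smooth hg.cpt

end IsProfile

/-- **the side-2 partition profile** `χ(t) = hprof(t − 1)²` (r01's [Balaban1983RegularityDecay] p. 575 plateau profile, squared and centred at `1`:
support `]3/8, 13/8[ ⊂ ]0, 2[`, `= 1` on `[5/8, 11/8]`, and `Σ_{n∈ℤ} χ(t − n) = 1`). [cite: Balaban1983Higgs3, p.420] -/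
def prof2 (t : ℝ) : ℝ := hprof (t - 1) ^ 2

/-- **the side-3 bump profile** `θ(t) = hprof(3t/4 − 9/8)`: `= 1` on the middle unit interval `[1, 2]`, support `]2/3, 7/3[ ⊂ ]0, 3[`.
[cite: Balaban1983Higgs3, p.420] -/
def prof3 (t : ℝ) : ℝ := hprof (3 / 4 * t - 9 / 8)

/-- `0 ≤ χ`. [cite: Balaban1983Higgs3, p.420] -/
theorem prof2_nonneg (t : ℝ) : 0 ≤ prof2 t := sq_nonneg _

/-- `χ ≤ 1`. [cite: Balaban1983Higgs3, p.420] -/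
theorem prof2_le_one (t : ℝ) : prof2 t ≤ 1 := by
  unfold prof2; rw [sq]; exact mul_le_one₀ (hprof_le_one _) (hprof_nonneg _) (hprof_le_one _)

/-- `χ(t) ≠ 0 ⇒ 3/8 < t < 13/8`. [cite: Balaban1983Higgs3, p.420] -/
theorem prof2_support {t : ℝ} (h : prof2 t ≠ 0) : 3 / 8 < t ∧ t < 13 / 8 := by
  have h1 : hprof (t - 1) ≠ 0 := fun h0 => h (by rw [prof2, h0]; ring)
  have h2 : |t - 1| < 5 / 8 := by by_contra hc; exact h1 (hprof_eq_zero (not_lt.1 hc))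
  rw [abs_lt] at h2; constructor <;> linarith [h2.1, h2.2]

/-- `χ` is `C^∞`. [cite: Balaban1983Higgs3, p.420] -/
theorem contDiff_prof2 : ContDiff ℝ ∞ prof2 :=
  (contDiff_hprof.comp (contDiff_id.sub contDiff_const)).pow 2

/-- `χ` has compact support (inside `[0, 2]`). [cite: Balaban1983Higgs3, p.420] -/
theorem hasCompactSupport_prof2 : HasCompactSupport prof2 := by
  refine HasCompactSupport.intro (K := Set.Icc (0 : ℝ) 2) isCompact_Icc fun t ht => ?_
  by_contra h
  have := prof2_support h
  exact ht ⟨by linarith [this.1], by linarith [this.2]⟩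

/-- `χ` is an admissible side-2 profile. [cite: Balaban1983Higgs3, p.420] -/
theorem isProfile_prof2 : IsProfile 2 prof2 where
  smooth := contDiff_prof2
  cpt := hasCompactSupport_prof2
  abs_le t := by rw [abs_of_nonneg (prof2_nonneg t)]; exact prof2_le_one t
  supp t h := by have := prof2_support h; push_cast; constructor <;> linarith [this.1, this.2]

/-- `0 ≤ θ`. [cite: Balaban1983Higgs3, p.420] -/
theorem prof3_nonneg (t : ℝ) : 0 ≤ prof3 t := hprof_nonneg _

/-- `θ ≤ 1`. [cite: Balaban1983Higgs3, p.420] -/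
theorem prof3_le_one (t : ℝ) : prof3 t ≤ 1 := hprof_le_one _

/-- **`θ = 1` on the middle unit interval `[1, 2]`** («h = 1 on □(v)»). [cite: Balaban1983Higgs3, p.420] -/
theorem prof3_eq_one {t : ℝ} (h1 : 1 ≤ t) (h2 : t ≤ 2) : prof3 t = 1 := by
  unfold prof3; apply hprof_eq_one; rw [abs_le]; constructor <;> linarith

/-- `θ(t) ≠ 0 ⇒ 2/3 < t < 7/3` («h = 0 outside some neighborhood of □(v)»: the neighbourhood lies inside the ring of adjacent cubes).
[cite: Balaban1983Higgs3, p.420] -/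
theorem prof3_support {t : ℝ} (h : prof3 t ≠ 0) : 2 / 3 < t ∧ t < 7 / 3 := by
  have h2 : |3 / 4 * t - 9 / 8| < 5 / 8 := by by_contra hc; exact h (hprof_eq_zero (not_lt.1 hc))
  rw [abs_lt] at h2; constructor <;> linarith [h2.1, h2.2]

/-- `θ` is `C^∞`. [cite: Balaban1983Higgs3, p.420] -/
theorem contDiff_prof3 : ContDiff ℝ ∞ prof3 :=
  contDiff_hprof.comp ((contDiff_const.mul contDiff_id).sub contDiff_const)

/-- `θ` has compact support (inside `[0, 3]`). [cite: Balaban1983Higgs3, p.420] -/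
theorem hasCompactSupport_prof3 : HasCompactSupport prof3 := by
  refine HasCompactSupport.intro (K := Set.Icc (0 : ℝ) 3) isCompact_Icc fun t ht => ?_
  by_contra h
  have := prof3_support h
  exact ht ⟨by linarith [this.1], by linarith [this.2]⟩

/-- `θ` is an admissible side-3 profile. [cite: Balaban1983Higgs3, p.420] -/
theorem isProfile_prof3 : IsProfile 3 prof3 where
  smooth := contDiff_prof3
  cpt := hasCompactSupport_prof3
  abs_le t := by rw [abs_of_nonneg (prof3_nonneg t)]; exact prof3_le_one t
  supp t h := by have := prof3_support h; push_cast; constructor <;> linarith [this.1, this.2]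

end RealVar

/-! ## §2 A telescoping bound for finite products -/

section Products

/-- **telescoping**: if `|aᵢ|, |bᵢ| ≤ Mᵢ` and `|aᵢ − bᵢ| ≤ δᵢ` then `|∏ᵢ aᵢ − ∏ᵢ bᵢ| ≤ Σᵢ δᵢ·∏_{j ≠ i} Mⱼ`. [folklore] -/
private theorem abs_prod_sub_prod_le {ι : Type*} [DecidableEq ι] (s : Finset ι) {a b M δ : ι → ℝ}
    (hM : ∀ i ∈ s, 0 ≤ M i) (ha : ∀ i ∈ s, |a i| ≤ M i) (hb : ∀ i ∈ s, |b i| ≤ M i) (hδ : ∀ i ∈ s, |a i - b i| ≤ δ i) :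
    |∏ i ∈ s, a i - ∏ i ∈ s, b i| ≤ ∑ i ∈ s, δ i * ∏ j ∈ s.erase i, M j := by
  induction s using Finset.induction_on with
  | empty => simp
  | @insert i s hi ih =>
    have hM' : ∀ j ∈ s, 0 ≤ M j := fun j hj => hM j (mem_insert_of_mem hj)
    have ih' := ih hM' (fun j hj => ha j (mem_insert_of_mem hj)) (fun j hj => hb j (mem_insert_of_mem hj))
      (fun j hj => hδ j (mem_insert_of_mem hj))
    have hA : |∏ j ∈ s, a j| ≤ ∏ j ∈ s, M j := by
      rw [Finset.abs_prod]; exact Finset.prod_le_prod (fun j _ => abs_nonneg _) fun j hj => ha j (mem_insert_of_mem hj)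
    have hMi : 0 ≤ M i := hM i (mem_insert_self i s)
    have hbi : |b i| ≤ M i := hb i (mem_insert_self i s)
    have hδi : |a i - b i| ≤ δ i := hδ i (mem_insert_self i s)
    rw [Finset.prod_insert hi, Finset.prod_insert hi, Finset.sum_insert hi, Finset.erase_insert hi]
    have hrest : ∑ j ∈ s, δ j * ∏ l ∈ (insert i s).erase j, M l = M i * ∑ j ∈ s, δ j * ∏ l ∈ s.erase j, M l := by
      rw [Finset.mul_sum]
      refine Finset.sum_congr rfl fun j hj => ?_
      have hne : i ≠ j := fun h => hi (h ▸ hj)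
      rw [Finset.erase_insert_of_ne hne, Finset.prod_insert (fun h => hi (Finset.mem_of_mem_erase h))]
      ring
    rw [hrest]
    have e : a i * ∏ j ∈ s, a j - b i * ∏ j ∈ s, b j =
        (a i - b i) * ∏ j ∈ s, a j + b i * (∏ j ∈ s, a j - ∏ j ∈ s, b j) := by ring
    rw [e]
    calc |(a i - b i) * ∏ j ∈ s, a j + b i * (∏ j ∈ s, a j - ∏ j ∈ s, b j)|
        ≤ |(a i - b i) * ∏ j ∈ s, a j| + |b i * (∏ j ∈ s, a j - ∏ j ∈ s, b j)| := abs_add_le _ _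
      _ = |a i - b i| * |∏ j ∈ s, a j| + |b i| * |∏ j ∈ s, a j - ∏ j ∈ s, b j| := by rw [abs_mul, abs_mul]
      _ ≤ δ i * ∏ j ∈ s, M j + M i * ∑ j ∈ s, δ j * ∏ l ∈ s.erase j, M l :=
          add_le_add (mul_le_mul hδi hA (abs_nonneg _) ((abs_nonneg _).trans hδi))
            (mul_le_mul hbi ih' (abs_nonneg _) hMi)

/-- a product of factors of modulus `≤ 1` has modulus `≤ 1`. [folklore] -/
private theorem abs_prod_le_one {ι : Type*} (s : Finset ι) {a : ι → ℝ} (ha : ∀ i ∈ s, |a i| ≤ 1) : |∏ i ∈ s, a i| ≤ 1 := by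
  rw [Finset.abs_prod]; exact Finset.prod_le_one (fun i _ => abs_nonneg _) ha

end Products

/-! ## §3 Torus calculus: labels under `± 1`, relative coordinates, periodic boxes, the circular Lipschitz lemma -/

section Torus

variable {k : ℕ}

/-- the tori of record have at least two sites in every direction (`|T_ε|_μ = 2L^{K}ML′_μ`). [cite: Balaban1982Higgs1, (1.2) p.604] -/
theorem one_lt_sitesPerDir (P : HiggsLattice.Params) (μ : Fin P.d) : 1 < P.sitesPerDir 0 μ := by
  have h := P.sitesPerDir_pos 0 μ
  unfold HiggsLattice.Params.sitesPerDir at h ⊢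
  omega

/-- `(1 : ZMod n).val = 1` for `n > 1`. [folklore] -/
private theorem val_one' {n : ℕ} [NeZero n] (hn : 1 < n) : (1 : ZMod n).val = 1 := by
  rw [ZMod.val_one_eq_one_mod, Nat.mod_eq_of_lt hn]

/-- the label of `w + 1`: `w.val + 1` unless that is the period, then `0`. [folklore] -/
private theorem val_add_one {n : ℕ} [NeZero n] (hn : 1 < n) (w : ZMod n) :
    (w + 1).val = if w.val + 1 < n then w.val + 1 else 0 := by
  rw [ZMod.val_add, val_one' hn]
  split_ifs with h
  · exact Nat.mod_eq_of_lt h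
  · have : w.val + 1 = n := by have := ZMod.val_lt w; omega
    rw [this, Nat.mod_self]

/-- the label of `w − 1`: `w.val − 1` unless `w = 0`, then `n − 1`. [folklore] -/
private theorem val_sub_one {n : ℕ} [NeZero n] (hn : 1 < n) (w : ZMod n) :
    (w - 1).val = if 1 ≤ w.val then w.val - 1 else n - 1 := by
  split_ifs with h
  · rw [ZMod.val_sub (by rw [val_one' hn]; exact h), val_one' hn]
  · have hw : w = 0 := by rw [← ZMod.val_eq_zero]; omega
    subst hw
    have h1 : (1 : ZMod n) ≠ 0 := by
      intro h0; have := congrArg ZMod.val h0; rw [val_one' hn, ZMod.val_zero] at this; exact one_ne_zero this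
    rw [zero_sub, ZMod.neg_val, if_neg h1, val_one' hn]

/-- `(x − e_μ)_μ = x_μ − 1`. [cite: Balaban1982Higgs1, (1.2) p.604] -/
theorem unshift_apply_self (x : HiggsLattice.Site P 0) (μ : Fin P.d) : x.unshift μ μ = x μ - 1 := by
  simp [HiggsLattice.Site.unshift]

/-- `(x − e_μ)_ν = x_ν` for `ν ≠ μ`. [cite: Balaban1982Higgs1, (1.2) p.604] -/
theorem unshift_apply_ne (x : HiggsLattice.Site P 0) {μ ν : Fin P.d} (h : ν ≠ μ) : x.unshift μ ν = x ν := by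
  simp [HiggsLattice.Site.unshift, Function.update_of_ne h]

/-- **the relative coordinate of `x` seen from the corner `c` in `η`-units**: `t_μ = (x_μ − c_μ).val / L^k ∈ [0, |T_ε|_μ/L^k)` (periodic in
`x − c`). [cite: Balaban1983Higgs3, p.420] [cite: Balaban1982Higgs1, (1.2) p.604] -/
def relC (k : ℕ) (c x : HiggsLattice.Site P 0) (μ : Fin P.d) : ℝ := (((x μ - c μ).val : ℕ) : ℝ) / (P.L : ℝ) ^ k

/-- `t_μ ≥ 0`. [cite: Balaban1983Higgs3, p.420] -/
theorem relC_nonneg (c x : HiggsLattice.Site P 0) (μ : Fin P.d) : 0 ≤ relC k c x μ :=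
  div_nonneg (Nat.cast_nonneg _) (pow_nonneg (Nat.cast_nonneg _) _)

/-- a lattice step in direction `μ` does not move the other relative coordinates. [cite: Balaban1982Higgs1, (1.2) p.604] -/
theorem relC_shift_ne (c x : HiggsLattice.Site P 0) {μ ν : Fin P.d} (h : ν ≠ μ) : relC k c (x.shift μ) ν = relC k c x ν := by
  unfold relC; rw [shift_apply_ne x h]

/-- a backward lattice step in direction `μ` does not move the other relative coordinates. [cite: Balaban1982Higgs1, (1.2) p.604] -/
theorem relC_unshift_ne (c x : HiggsLattice.Site P 0) {μ ν : Fin P.d} (h : ν ≠ μ) : relC k c (x.unshift μ) ν = relC k c x ν := by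
  unfold relC; rw [unshift_apply_ne x h]

/-- the relative label after a forward step: `(x + e_μ − c)_μ = (x − c)_μ + 1`. [cite: Balaban1982Higgs1, (1.2) p.604] -/
theorem sub_shift_self (c x : HiggsLattice.Site P 0) (μ : Fin P.d) : x.shift μ μ - c μ = (x μ - c μ) + 1 := by
  rw [shift_apply_self]; ring

/-- the relative label after a backward step: `(x − e_μ − c)_μ = (x − c)_μ − 1`. [cite: Balaban1982Higgs1, (1.2) p.604] -/
theorem sub_unshift_self (c x : HiggsLattice.Site P 0) (μ : Fin P.d) : x.unshift μ μ - c μ = (x μ - c μ) - 1 := by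
  rw [unshift_apply_self]; ring

/-- **a profile does not see the seam**: for a side-`m` profile `g`, a fine step `L^{−k} ≤ 1/4` and a box that fits (`mL^k ≤ |T_ε|_μ`),
`g(t_μ(x + e_μ)) = g(t_μ(x) + L^{−k})` — on the wrap-around bond both sides vanish. [cite: Balaban1983Higgs3, p.420] -/
theorem prof_relC_shift {m : ℕ} {g : ℝ → ℝ} (hg : IsProfile m g) (hT : 4 ≤ P.L ^ k) {μ : Fin P.d}
    (hm : m * P.L ^ k ≤ P.sitesPerDir 0 μ) (c x : HiggsLattice.Site P 0) :
    g (relC k c (x.shift μ) μ) = g (relC k c x μ + ((P.L : ℝ) ^ k)⁻¹) := by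
  have hn := one_lt_sitesPerDir P μ
  have hTpos : (0 : ℝ) < (P.L : ℝ) ^ k := pow_pos (by exact_mod_cast P.hL) k
  have hT' : (4 : ℝ) ≤ (P.L : ℝ) ^ k := by exact_mod_cast hT
  unfold relC
  rw [sub_shift_self, val_add_one hn]
  split_ifs with h
  · push_cast; rw [add_div, one_div]
  · -- the wrap-around bond: both arguments are outside the support
    have hv : (x μ - c μ).val + 1 = P.sitesPerDir 0 μ := by have := ZMod.val_lt (x μ - c μ); omega
    have hl : g (((0 : ℕ) : ℝ) / (P.L : ℝ) ^ k) = 0 := hg.eq_zero_of_le (by simp)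
    have hr : g ((((x μ - c μ).val : ℕ) : ℝ) / (P.L : ℝ) ^ k + ((P.L : ℝ) ^ k)⁻¹) = 0 := by
      apply hg.eq_zero_of_ge
      have hv' : ((P.sitesPerDir 0 μ : ℕ) : ℝ) = (((x μ - c μ).val : ℕ) : ℝ) + 1 := by exact_mod_cast hv.symm
      have e : (((x μ - c μ).val : ℕ) : ℝ) / (P.L : ℝ) ^ k + ((P.L : ℝ) ^ k)⁻¹ = (P.sitesPerDir 0 μ : ℝ) / (P.L : ℝ) ^ k := by
        rw [hv', add_div, one_div]
      rw [e, le_div_iff₀ hTpos]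
      have : (m : ℝ) * (P.L : ℝ) ^ k ≤ P.sitesPerDir 0 μ := by exact_mod_cast hm
      nlinarith
    rw [hl, hr]

/-- the same for a backward step: `g(t_μ(x − e_μ)) = g(t_μ(x) − L^{−k})`. [cite: Balaban1983Higgs3, p.420] -/
theorem prof_relC_unshift {m : ℕ} {g : ℝ → ℝ} (hg : IsProfile m g) (hT : 4 ≤ P.L ^ k) {μ : Fin P.d}
    (hm : m * P.L ^ k ≤ P.sitesPerDir 0 μ) (c x : HiggsLattice.Site P 0) :
    g (relC k c (x.unshift μ) μ) = g (relC k c x μ - ((P.L : ℝ) ^ k)⁻¹) := by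
  have hn := one_lt_sitesPerDir P μ
  have hTpos : (0 : ℝ) < (P.L : ℝ) ^ k := pow_pos (by exact_mod_cast P.hL) k
  have hT' : (4 : ℝ) ≤ (P.L : ℝ) ^ k := by exact_mod_cast hT
  unfold relC
  rw [sub_unshift_self, val_sub_one hn]
  split_ifs with h
  · rw [Nat.cast_sub h]; push_cast; rw [sub_div, one_div]
  · have hv : (x μ - c μ).val = 0 := by omega
    have hl : g ((((P.sitesPerDir 0 μ - 1 : ℕ) : ℝ)) / (P.L : ℝ) ^ k) = 0 := by
      apply hg.eq_zero_of_ge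
      rw [le_div_iff₀ hTpos, Nat.cast_sub hn.le]
      have : (m : ℝ) * (P.L : ℝ) ^ k ≤ P.sitesPerDir 0 μ := by exact_mod_cast hm
      push_cast; nlinarith
    have hr : g ((((x μ - c μ).val : ℕ) : ℝ) / (P.L : ℝ) ^ k - ((P.L : ℝ) ^ k)⁻¹) = 0 := by
      apply hg.eq_zero_of_le
      rw [hv, Nat.cast_zero, zero_div, zero_sub]
      have : 0 < ((P.L : ℝ) ^ k)⁻¹ := inv_pos.2 hTpos
      linarith
    rw [hl, hr]

/-- **the periodic box of `m` unit cubes a side with corner `c`**: the sites whose relative label is `< mL^k` in every direction (it may wrap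
around the coordinate seam of `T_ε`). [cite: Balaban1983Higgs3, p.420] -/
def pboxSet (k : ℕ) (c : HiggsLattice.Site P 0) (m : ℕ) : Finset (HiggsLattice.Site P 0) :=
  Finset.univ.filter fun x => ∀ μ, (x μ - c μ).val < m * P.L ^ k

/-- membership in the periodic box. [cite: Balaban1983Higgs3, p.420] -/
theorem mem_pboxSet {c : HiggsLattice.Site P 0} {m : ℕ} {x : HiggsLattice.Site P 0} :
    x ∈ pboxSet k c m ↔ ∀ μ, (x μ - c μ).val < m * P.L ^ k := by
  simp [pboxSet]

/-- **a non-wrapping periodic box with cube-aligned corner IS p40's box**: if `L^k ∣ c_μ` and `c_μ + mL^k ≤ |T_ε|_μ` for all `μ` then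
`pboxSet k c m = boxSet k (c/L^k) m`. [cite: Balaban1983Higgs3, p.420] [cite: Balaban1982Higgs1, (1.20) p.607] -/
theorem pboxSet_eq_boxSet {c : HiggsLattice.Site P 0} {m : ℕ} (hc : ∀ μ, P.L ^ k ∣ (c μ).val)
    (hfit : ∀ μ, (c μ).val + m * P.L ^ k ≤ P.sitesPerDir 0 μ) :
    pboxSet k c m = boxSet k (fun μ => (c μ).val / P.L ^ k) m := by
  have hT : 0 < P.L ^ k := pow_pos P.hL k
  ext x
  rw [mem_pboxSet, mem_boxSet]
  unfold InBox
  refine forall_congr' fun μ => ?_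
  obtain ⟨q, hq⟩ := hc μ
  have hqd : (c μ).val / P.L ^ k = q := by rw [hq, Nat.mul_div_cancel_left _ hT]
  show (x μ - c μ).val < m * P.L ^ k ↔ (c μ).val / P.L ^ k ≤ (x μ).val / P.L ^ k ∧ (x μ).val / P.L ^ k < (c μ).val / P.L ^ k + m
  rw [hqd, Nat.le_div_iff_mul_le hT, Nat.div_lt_iff_lt_mul hT]
  have hfit' := hfit μ
  constructor
  · intro h
    by_cases hle : (c μ).val ≤ (x μ).val
    · rw [ZMod.val_sub hle] at h
      constructor
      · rw [mul_comm, ← hq]; exact hle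
      · rw [add_mul, mul_comm q, ← hq]; omega
    · exfalso
      push Not at hle
      have hcx : (x μ - c μ).val = P.sitesPerDir 0 μ - ((c μ).val - (x μ).val) := by
        have hne : c μ - x μ ≠ 0 := by
          intro h0; have := congrArg ZMod.val h0; rw [ZMod.val_sub hle.le, ZMod.val_zero] at this; omega
        rw [← neg_sub, ZMod.neg_val, if_neg hne, ZMod.val_sub hle.le]
      rw [hcx] at h
      omega
  · rintro ⟨h1, h2⟩
    have hle : (c μ).val ≤ (x μ).val := by rw [hq, mul_comm]; exact h1
    rw [ZMod.val_sub hle]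
    rw [add_mul, mul_comm q, ← hq] at h2
    omega

/-- **the circular Lipschitz lemma**: a `K`-Lipschitz function of the label that vanishes at `0` and at the period `n` changes, between two
labels, by at most `K` times their ORIENTED circular distance `(a − b).val` — going around the seam costs nothing extra because `F` vanishes
there. [cite: Balaban1982Higgs1, (1.3) p.604] -/
theorem abs_sub_le_mul_val {n : ℕ} [NeZero n] {F : ℝ → ℝ} {K : ℝ}
    (hF : ∀ s s' : ℝ, |F s - F s'| ≤ K * |s - s'|) (h0 : F 0 = 0) (hn : F n = 0) (a b : ZMod n) :
    |F a.val - F b.val| ≤ K * ((a - b).val : ℝ) := by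
  rcases le_or_gt b.val a.val with h | h
  · rw [ZMod.val_sub h, Nat.cast_sub h]
    calc |F a.val - F b.val| ≤ K * |(a.val : ℝ) - b.val| := hF _ _
      _ = K * ((a.val : ℝ) - b.val) := by rw [abs_of_nonneg (by rw [sub_nonneg]; exact_mod_cast h)]
  · have hba : (b - a).val = b.val - a.val := ZMod.val_sub h.le
    have hne : b - a ≠ 0 := by
      intro h0'; have := congrArg ZMod.val h0'; rw [hba, ZMod.val_zero] at this; omega
    have hval : (a - b).val = n - (b.val - a.val) := by
      rw [← neg_sub, ZMod.neg_val, if_neg hne, hba]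
    have hbn : b.val < n := ZMod.val_lt b
    have hcast : ((n - (b.val - a.val) : ℕ) : ℝ) = ((n : ℝ) - b.val) + a.val := by
      rw [Nat.cast_sub (by omega), Nat.cast_sub h.le]; ring
    rw [hval, hcast]
    calc |F a.val - F b.val| = |(F n - F b.val) + (F a.val - F 0)| := by rw [h0, hn]; ring_nf
      _ ≤ |F n - F b.val| + |F a.val - F 0| := abs_add_le _ _
      _ ≤ K * |(n : ℝ) - b.val| + K * |(a.val : ℝ) - 0| := add_le_add (hF _ _) (hF _ _)
      _ = K * (((n : ℝ) - b.val) + a.val) := by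
          rw [sub_zero, abs_of_nonneg (by rw [sub_nonneg]; exact_mod_cast hbn.le), abs_of_nonneg (Nat.cast_nonneg _)]; ring

/-- **… hence by `K` times the torus distance (1.3)** in that coordinate: `|F((x′−c)_ν) − F((x−c)_ν)| ≤ K·min((x−x′)_ν.val, (x′−x)_ν.val) ≤ K·|x − x′|`.
[cite: Balaban1982Higgs1, (1.3) p.604] -/
theorem abs_sub_le_mul_tdist {F : ℝ → ℝ} {K : ℝ} (hK : 0 ≤ K) {ν : Fin P.d}
    (hF : ∀ s s' : ℝ, |F s - F s'| ≤ K * |s - s'|) (h0 : F 0 = 0) (hn : F (P.sitesPerDir 0 ν) = 0)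
    (c x x' : HiggsLattice.Site P 0) :
    |F ((x' ν - c ν).val) - F ((x ν - c ν).val)| ≤ K * (HiggsLattice.Site.tdist x x' : ℝ) := by
  have h1 := abs_sub_le_mul_val hF h0 hn (x' ν - c ν) (x ν - c ν)
  have h2 := abs_sub_le_mul_val hF h0 hn (x ν - c ν) (x' ν - c ν)
  rw [abs_sub_comm] at h2
  have e1 : x' ν - c ν - (x ν - c ν) = x' ν - x ν := by ring
  have e2 : x ν - c ν - (x' ν - c ν) = x ν - x' ν := by ring
  rw [e1] at h1; rw [e2] at h2
  have hmin : (min (x ν - x' ν).val (x' ν - x ν).val : ℕ) ≤ HiggsLattice.Site.tdist x x' :=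
    Finset.le_sup (f := fun μ => min (x μ - x' μ).val (x' μ - x μ).val) (Finset.mem_univ ν)
  have hmin' : ((min (x ν - x' ν).val (x' ν - x ν).val : ℕ) : ℝ) ≤ (HiggsLattice.Site.tdist x x' : ℝ) := by exact_mod_cast hmin
  refine le_trans ?_ (mul_le_mul_of_nonneg_left hmin' hK)
  rcases min_choice (x ν - x' ν).val (x' ν - x ν).val with h | h <;> rw [h]
  · exact h2
  · exact h1

end Torus

/-! ## §4 The generic product bump is a smooth localization function of p. 420 -/

section Bump

variable {k m : ℕ} {g : ℝ → ℝ}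

/-- **the product bump with corner `c`**: `h(x) = ∏_μ g(t_μ(x))`, `t_μ = (x_μ − c_μ).val/L^k`. [cite: Balaban1983Higgs3, p.420] -/
def bump (g : ℝ → ℝ) (k : ℕ) (c : HiggsLattice.Site P 0) (x : HiggsLattice.Site P 0) : ℝ := ∏ μ, g (relC k c x μ)

/-- the difference quotient of the profile at the fine step `1/T`: `q(t) = T(g(t + 1/T) − g(t))` — the one-variable factor of `∂^η_μh`.
[cite: Balaban1983Higgs3, (1.32) p.420] -/
def dq (g : ℝ → ℝ) (T t : ℝ) : ℝ := T * (g (t + T⁻¹) - g t)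

/-- `|q| ≤ sup|g′|` (mean value). [cite: Balaban1983Higgs3, (1.32) p.420] -/
theorem abs_dq_le (hg : IsProfile m g) {T : ℝ} (hT : 0 < T) (t : ℝ) : |dq g T t| ≤ D1 g := by
  unfold dq
  rw [abs_mul, abs_of_pos hT]
  have h := hg.lip (t + T⁻¹) t
  rw [add_sub_cancel_left, abs_of_pos (inv_pos.2 hT)] at h
  calc T * |g (t + T⁻¹) - g t| ≤ T * (D1 g * T⁻¹) := mul_le_mul_of_nonneg_left h hT.le
    _ = D1 g := by field_simp

/-- `q` is `sup|g″|`-Lipschitz, uniformly in the step (the mixed second difference). [cite: Balaban1983Higgs3, (1.32) p.420] -/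
theorem abs_dq_sub_dq_le (hg : IsProfile m g) {T : ℝ} (hT : 0 < T) (t t' : ℝ) : |dq g T t - dq g T t'| ≤ D2 g * |t - t'| := by
  unfold dq
  rw [← mul_sub, abs_mul, abs_of_pos hT]
  have h := abs_mixed_diff_le_D2 hg.smooth hg.cpt t t' T⁻¹
  rw [abs_of_pos (inv_pos.2 hT)] at h
  calc T * |g (t + T⁻¹) - g t - (g (t' + T⁻¹) - g t')| ≤ T * (D2 g * T⁻¹ * |t - t'|) := mul_le_mul_of_nonneg_left h hT.le
    _ = D2 g * |t - t'| := by field_simp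

/-- `q(t) = 0` for `t ≤ 0` once the step is `≤ 1/4`. [cite: Balaban1983Higgs3, p.420] -/
theorem dq_eq_zero_of_nonpos (hg : IsProfile m g) {T : ℝ} (hT : 4 ≤ T) {t : ℝ} (ht : t ≤ 0) : dq g T t = 0 := by
  have hTpos : 0 < T := by linarith
  have hinv : T⁻¹ ≤ 1 / 4 := by rw [inv_eq_one_div]; exact one_div_le_one_div_of_le (by norm_num) hT
  unfold dq
  rw [hg.eq_zero_of_le (by linarith), hg.eq_zero_of_le (by linarith), sub_zero, mul_zero]

/-- `q(t) = 0` for `t ≥ m − 1/4`. [cite: Balaban1983Higgs3, p.420] -/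
theorem dq_eq_zero_of_ge (hg : IsProfile m g) {T : ℝ} (hT : 0 < T) {t : ℝ} (ht : (m : ℝ) - 1 / 4 ≤ t) : dq g T t = 0 := by
  have hinv : 0 < T⁻¹ := inv_pos.2 hT
  unfold dq
  rw [hg.eq_zero_of_ge (by linarith), hg.eq_zero_of_ge ht, sub_zero, mul_zero]

/-- splitting off one factor: `h(x) = g(t_μ)·∏_{ν≠μ} g(t_ν)`. [cite: Balaban1983Higgs3, p.420] -/
theorem bump_eq_mul_prod_erase (g : ℝ → ℝ) (c x : HiggsLattice.Site P 0) (μ : Fin P.d) :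
    bump g k c x = g (relC k c x μ) * ∏ ν ∈ Finset.univ.erase μ, g (relC k c x ν) :=
  (Finset.mul_prod_erase Finset.univ (fun ν => g (relC k c x ν)) (Finset.mem_univ μ)).symm

/-- the bump one step on: `h(x + e_μ) = g(t_μ + L^{−k})·∏_{ν≠μ} g(t_ν)` (also across the seam). [cite: Balaban1983Higgs3, p.420] -/
theorem bump_shift (hg : IsProfile m g) (hT : 4 ≤ P.L ^ k) {μ : Fin P.d} (hm : m * P.L ^ k ≤ P.sitesPerDir 0 μ)
    (c x : HiggsLattice.Site P 0) :
    bump g k c (x.shift μ) = g (relC k c x μ + ((P.L : ℝ) ^ k)⁻¹) * ∏ ν ∈ Finset.univ.erase μ, g (relC k c x ν) := by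
  rw [bump_eq_mul_prod_erase g c (x.shift μ) μ, prof_relC_shift hg hT hm]
  congr 1
  exact Finset.prod_congr rfl fun ν hν => by rw [relC_shift_ne c x (Finset.ne_of_mem_erase hν)]

/-- **the `η`-lattice derivative of the bump, EXACTLY**: `(∂^η_μh)(x) = L^k(g(t_μ + L^{−k}) − g(t_μ))·∏_{ν≠μ} g(t_ν)` for every bond, the
wrap-around bond of the coordinate seam included. [cite: Balaban1983Higgs3, (1.32) p.420] -/
theorem dEta_bump (hg : IsProfile m g) (hT : 4 ≤ P.L ^ k) {μ : Fin P.d} (hm : m * P.L ^ k ≤ P.sitesPerDir 0 μ)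
    (c x : HiggsLattice.Site P 0) :
    dEta k (bump g k c) ⟨x, μ⟩ = dq g ((P.L : ℝ) ^ k) (relC k c x μ) * ∏ ν ∈ Finset.univ.erase μ, g (relC k c x ν) := by
  unfold dEta dq
  show (P.L : ℝ) ^ k * (bump g k c (x.shift μ) - bump g k c x) = _
  rw [bump_shift hg hT hm, bump_eq_mul_prod_erase g c x μ]
  ring

/-- the factors of `∂^η_μh` as one family: `f_ν = q` for `ν = μ`, `f_ν = g` otherwise. [cite: Balaban1983Higgs3, (1.32) p.420] -/
def dfac (g : ℝ → ℝ) (T : ℝ) (μ ν : Fin P.d) (t : ℝ) : ℝ := if ν = μ then dq g T t else g t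

/-- `∂^η_μh = ∏_ν f_ν(t_ν)`. [cite: Balaban1983Higgs3, (1.32) p.420] -/
theorem dEta_bump_eq_prod (hg : IsProfile m g) (hT : 4 ≤ P.L ^ k) {μ : Fin P.d} (hm : m * P.L ^ k ≤ P.sitesPerDir 0 μ)
    (c x : HiggsLattice.Site P 0) :
    dEta k (bump g k c) ⟨x, μ⟩ = ∏ ν, dfac g ((P.L : ℝ) ^ k) μ ν (relC k c x ν) := by
  rw [dEta_bump hg hT hm, ← Finset.mul_prod_erase Finset.univ _ (Finset.mem_univ μ)]
  unfold dfac
  rw [if_pos rfl]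
  congr 1
  exact Finset.prod_congr rfl fun ν hν => by rw [if_neg (Finset.ne_of_mem_erase hν)]

/-- **each factor is Lipschitz IN THE TORUS DISTANCE**: `|f_ν(t_ν(x′)) − f_ν(t_ν(x))| ≤ Lip_ν·|x − x′|/L^k` with `Lip_μ = sup|g″|`,
`Lip_ν = sup|g′|` (`ν ≠ μ`) — the circular Lipschitz lemma, the factor vanishing on the seam. [cite: Balaban1983Higgs3, (1.32) p.420]
[cite: Balaban1982Higgs1, (1.3) p.604] -/
theorem abs_dfac_sub_le (hg : IsProfile m g) (hT : 4 ≤ P.L ^ k) (μ : Fin P.d) {ν : Fin P.d} (hm : m * P.L ^ k ≤ P.sitesPerDir 0 ν)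
    (c x x' : HiggsLattice.Site P 0) :
    |dfac g ((P.L : ℝ) ^ k) μ ν (relC k c x' ν) - dfac g ((P.L : ℝ) ^ k) μ ν (relC k c x ν)|
      ≤ (if ν = μ then D2 g else D1 g) * ((HiggsLattice.Site.tdist x x' : ℝ) / (P.L : ℝ) ^ k) := by
  have hT' : (4 : ℝ) ≤ (P.L : ℝ) ^ k := by exact_mod_cast hT
  have hTpos : (0 : ℝ) < (P.L : ℝ) ^ k := by linarith
  set T : ℝ := (P.L : ℝ) ^ k with hTdef
  set Lip : ℝ := if ν = μ then D2 g else D1 g with hLip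
  have hLip0 : 0 ≤ Lip := by rw [hLip]; split_ifs; exacts [hg.D2_nonneg, hg.D1_nonneg]
  -- the factor as a function of the label `s`, `F(s) = f_ν(s/T)`
  have hF : ∀ s s' : ℝ, |dfac g T μ ν (s / T) - dfac g T μ ν (s' / T)| ≤ Lip / T * |s - s'| := by
    intro s s'
    have e : Lip / T * |s - s'| = Lip * |s / T - s' / T| := by
      rw [← sub_div, abs_div, abs_of_pos hTpos]; ring
    rw [e, hLip]
    unfold dfac
    split_ifs with h
    · exact abs_dq_sub_dq_le hg hTpos _ _
    · exact hg.lip _ _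
  have h0 : dfac g T μ ν ((0 : ℕ) / T) = 0 := by
    unfold dfac; rw [Nat.cast_zero, zero_div]
    split_ifs
    · exact dq_eq_zero_of_nonpos hg hT' le_rfl
    · exact hg.eq_zero_of_le (by norm_num)
  have hmT : (m : ℝ) ≤ (P.sitesPerDir 0 ν : ℝ) / T := by
    rw [le_div_iff₀ hTpos, hTdef]; exact_mod_cast hm
  have hn : dfac g T μ ν ((P.sitesPerDir 0 ν : ℕ) / T) = 0 := by
    unfold dfac
    split_ifs
    · exact dq_eq_zero_of_ge hg hTpos (by linarith)
    · exact hg.eq_zero_of_ge (by linarith)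
  have key := abs_sub_le_mul_tdist (F := fun s : ℝ => dfac g T μ ν (s / T)) (div_nonneg hLip0 hTpos.le) hF
    (by simpa using h0) hn c x x'
  unfold relC
  calc |dfac g T μ ν ((((x' ν - c ν).val : ℕ) : ℝ) / T) - dfac g T μ ν ((((x ν - c ν).val : ℕ) : ℝ) / T)|
      ≤ Lip / T * (HiggsLattice.Site.tdist x x' : ℝ) := key
    _ = Lip * ((HiggsLattice.Site.tdist x x' : ℝ) / T) := by rw [div_mul_eq_mul_div, mul_div_assoc]

/-- **THE GENERIC BUMP IS A SMOOTH LOCALIZATION FUNCTION** (p40's class, exponent `1`): for a side-`m` profile `g`, a fine step `≤ 1/4`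
(`4 ≤ L^k`) and boxes that fit (`mL^k ≤ |T_ε|_μ`), `h = ∏_μ g(t_μ)` with corner `c` has `|h| ≤ 1`, `|∂^ηh| ≤ sup|g′|`, `∂^η_μh`
`d(sup|g″| + sup|g′|²)`-Lipschitz in `|x − x′|/L^k`, and `h` with its lattice collar is supported in the periodic side-`m` box `pboxSet k c m`.
[cite: Balaban1983Higgs3, p.420] [cite: Balaban1983Higgs3, (1.32) p.420] -/
theorem isSmoothLoc_bump (hg : IsProfile m g) (hT : 4 ≤ P.L ^ k) (hm : ∀ μ, m * P.L ^ k ≤ P.sitesPerDir 0 μ)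
    (c : HiggsLattice.Site P 0) :
    IsSmoothLoc k (D1 g) ((P.d : ℝ) * (D2 g + D1 g ^ 2)) 1 (pboxSet k c m) (bump g k c) := by
  have hT' : (4 : ℝ) ≤ (P.L : ℝ) ^ k := by exact_mod_cast hT
  have hTpos : (0 : ℝ) < (P.L : ℝ) ^ k := by linarith
  have hTn : 0 < P.L ^ k := pow_pos P.hL k
  refine ⟨fun x => abs_prod_le_one _ fun μ _ => hg.abs_le _, ?_, ?_, ?_⟩
  · -- `|∂^ηh| ≤ sup|g′|`
    rintro ⟨x, μ⟩
    rw [dEta_bump hg hT (hm μ), abs_mul]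
    calc |dq g ((P.L : ℝ) ^ k) (relC k c x μ)| * |∏ ν ∈ Finset.univ.erase μ, g (relC k c x ν)|
        ≤ D1 g * 1 := mul_le_mul (abs_dq_le hg hTpos _) (abs_prod_le_one _ fun ν _ => hg.abs_le _) (abs_nonneg _) hg.D1_nonneg
      _ = D1 g := mul_one _
  · -- `∂^η_μh` is Lipschitz in the torus distance
    intro μ x x'
    rw [Real.rpow_one, dEta_bump_eq_prod hg hT (hm μ), dEta_bump_eq_prod hg hT (hm μ)]
    set τ : ℝ := (HiggsLattice.Site.tdist x x' : ℝ) / (P.L : ℝ) ^ k with hτ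
    have hτ0 : 0 ≤ τ := div_nonneg (Nat.cast_nonneg _) hTpos.le
    have hM : ∀ ν ∈ (Finset.univ : Finset (Fin P.d)), (0 : ℝ) ≤ if ν = μ then D1 g else 1 := by
      intro ν _; split_ifs; exacts [hg.D1_nonneg, zero_le_one]
    have hab : ∀ (y : HiggsLattice.Site P 0), ∀ ν ∈ (Finset.univ : Finset (Fin P.d)),
        |dfac g ((P.L : ℝ) ^ k) μ ν (relC k c y ν)| ≤ if ν = μ then D1 g else 1 := by
      intro y ν _
      unfold dfac
      split_ifs
      · exact abs_dq_le hg hTpos _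
      · exact hg.abs_le _
    have step := abs_prod_sub_prod_le Finset.univ hM (hab x') (hab x) (fun ν _ => abs_dfac_sub_le hg hT μ (hm ν) c x x')
    refine step.trans ?_
    have hterm : ∀ ν ∈ (Finset.univ : Finset (Fin P.d)),
        (if ν = μ then D2 g else D1 g) * τ * ∏ j ∈ Finset.univ.erase ν, (if j = μ then D1 g else (1 : ℝ)) ≤ (D2 g + D1 g ^ 2) * τ := by
      intro ν _
      rw [Finset.prod_ite_eq' (Finset.univ.erase ν) μ (fun _ => D1 g)]
      have h1 := hg.D1_nonneg
      have h2 := hg.D2_nonneg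
      by_cases hν : ν = μ
      · subst hν
        rw [if_pos rfl, if_neg (by simp)]
        nlinarith [mul_nonneg (mul_nonneg h1 h1) hτ0]
      · rw [if_neg hν, if_pos (Finset.mem_erase.2 ⟨Ne.symm hν, Finset.mem_univ _⟩)]
        nlinarith [mul_nonneg h2 hτ0]
    calc ∑ ν, (if ν = μ then D2 g else D1 g) * τ * ∏ j ∈ Finset.univ.erase ν, (if j = μ then D1 g else (1 : ℝ))
        ≤ ∑ _ν : Fin P.d, (D2 g + D1 g ^ 2) * τ := Finset.sum_le_sum hterm
      _ = (P.d : ℝ) * (D2 g + D1 g ^ 2) * τ := by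
          rw [Finset.sum_const, Finset.card_univ, Fintype.card_fin, nsmul_eq_mul]; ring
  · -- support with collar in the periodic box
    intro x hx
    have hne : ∀ ν, g (relC k c x ν) ≠ 0 := fun ν => (Finset.prod_ne_zero_iff.1 hx) ν (Finset.mem_univ ν)
    -- label bounds `1 ≤ v_ν` and `v_ν + 1 < mL^k`
    have hv : ∀ ν, 1 ≤ (x ν - c ν).val ∧ (x ν - c ν).val + 1 < m * P.L ^ k := by
      intro ν
      obtain ⟨h1, h2⟩ := hg.supp _ (hne ν)
      unfold relC at h1 h2
      rw [lt_div_iff₀ hTpos] at h1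
      rw [div_lt_iff₀ hTpos] at h2
      constructor
      · have : (1 : ℝ) < ((x ν - c ν).val : ℕ) := by linarith
        exact_mod_cast this.le
      · have : (((x ν - c ν).val : ℕ) : ℝ) + 1 < (m : ℝ) * (P.L : ℝ) ^ k := by linarith
        exact_mod_cast this
    have hn1 : ∀ ν, 1 < P.sitesPerDir 0 ν := one_lt_sitesPerDir P
    refine ⟨mem_pboxSet.2 fun ν => by have := (hv ν).2; omega, fun μ => ⟨mem_pboxSet.2 fun ν => ?_, mem_pboxSet.2 fun ν => ?_⟩⟩
    · by_cases hν : ν = μ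
      · subst hν
        rw [sub_shift_self, val_add_one (hn1 ν), if_pos (by have := (hv ν).2; have := hm ν; omega)]
        exact (hv ν).2
      · rw [shift_apply_ne x hν]; have := (hv ν).2; omega
    · by_cases hν : ν = μ
      · subst hν
        rw [sub_unshift_self, val_sub_one (hn1 ν), if_pos (hv ν).1]
        have := (hv ν).2; omega
      · rw [unshift_apply_ne x hν]; have := (hv ν).2; omega

/-- **… at every exponent `0 ≤ α ≤ 1`** (a Lipschitz `∂^ηh` is `α`-Hölder with constant `c₂ + 2c₁`, p33 g61's `isSmoothLoc_of_lip`).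
[cite: Balaban1983Higgs3, p.420] [cite: Balaban1983Higgs3, (2.11) p.426] -/
theorem isSmoothLoc_bump_rpow (hg : IsProfile m g) (hT : 4 ≤ P.L ^ k) (hm : ∀ μ, m * P.L ^ k ≤ P.sitesPerDir 0 μ)
    (c : HiggsLattice.Site P 0) {α : ℝ} (hα0 : 0 ≤ α) (hα1 : α ≤ 1) :
    IsSmoothLoc k (D1 g) ((P.d : ℝ) * (D2 g + D1 g ^ 2) + 2 * D1 g) α (pboxSet k c m) (bump g k c) :=
  isSmoothLoc_of_lip hg.D1_nonneg (by have := hg.D1_nonneg; have := hg.D2_nonneg; positivity) hα0 hα1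
    (isSmoothLoc_bump hg hT hm c)

end Bump

/-! ## §5 The p. 420 objects: the external-field bump `= 1` on `□(v)`, and the vector-leg smooth partition of unity -/

section P420

variable {k : ℕ}

/-- `L^k ∣ |T_ε|_μ` for `k ≤ K` (the unit cubes of the `η`-lattice tile the torus). [cite: Balaban1982Higgs1, (1.20) p.607] -/
theorem pow_dvd_sitesPerDir (hk : k ≤ P.K) (μ : Fin P.d) : P.L ^ k ∣ P.sitesPerDir 0 μ := by
  unfold HiggsLattice.Params.sitesPerDir
  rw [Nat.sub_zero]
  exact Dvd.dvd.mul_left (Dvd.dvd.mul_right (Dvd.dvd.mul_right (pow_dvd_pow P.L hk) _) _) 2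

/-- `2L^k ≤ |T_ε|_μ` for `k ≤ K` (at least two unit cubes a side). [cite: Balaban1982Higgs1, (1.20) p.607] -/
theorem two_mul_pow_le_sitesPerDir (hk : k ≤ P.K) (μ : Fin P.d) : 2 * P.L ^ k ≤ P.sitesPerDir 0 μ := by
  unfold HiggsLattice.Params.sitesPerDir
  rw [Nat.sub_zero]
  have h1 : P.L ^ k ≤ P.L ^ P.K := Nat.pow_le_pow_right P.hL hk
  have h2 : 1 ≤ P.M := P.hM
  have h3 : 1 ≤ P.Lp μ := P.hLp μ
  calc 2 * P.L ^ k ≤ 2 * (P.L ^ P.K * 1 * 1) := by rw [mul_one, mul_one]; omega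
    _ ≤ 2 * (P.L ^ P.K * P.M * P.Lp μ) := by gcongr

/-! ### (a) the external-field bump: `h = 1` on `□(v)`, supported in the ring of adjacent cubes -/

/-- **the external-field bump with corner `c`**: `θ_c(x) = ∏_μ θ((x_μ − c_μ).val/L^k)` — `= 1` on the middle unit cube of the side-3 box at `c`,
`= 0` with its collar outside that box («h = 1 on □(v) and h = 0 outside some neighborhood of □(v)»). [cite: Balaban1983Higgs3, p.420] -/
def theta (k : ℕ) (c : HiggsLattice.Site P 0) : HiggsLattice.Site P 0 → ℝ := bump prof3 k c

/-- `0 ≤ θ_c ≤ 1`. [cite: Balaban1983Higgs3, p.420] -/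
theorem theta_mem_Icc (c x : HiggsLattice.Site P 0) : theta k c x ∈ Set.Icc (0 : ℝ) 1 := by
  unfold theta bump
  exact ⟨Finset.prod_nonneg fun μ _ => prof3_nonneg _, Finset.prod_le_one (fun μ _ => prof3_nonneg _) fun μ _ => prof3_le_one _⟩

/-- **`θ_c = 1` on the middle unit cube** `{x : L^k ≤ (x_μ − c_μ).val ≤ 2L^k ∀μ}` (it contains `□(v)`, `v = c + L^k𝟙`).
[cite: Balaban1983Higgs3, p.420] -/
theorem theta_eq_one {c x : HiggsLattice.Site P 0} (hx : ∀ μ, P.L ^ k ≤ (x μ - c μ).val ∧ (x μ - c μ).val ≤ 2 * P.L ^ k) :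
    theta k c x = 1 := by
  have hTpos : (0 : ℝ) < (P.L : ℝ) ^ k := pow_pos (by exact_mod_cast P.hL) k
  unfold theta bump
  refine Finset.prod_eq_one fun μ _ => prof3_eq_one ?_ ?_
  · rw [relC, le_div_iff₀ hTpos, one_mul]; exact_mod_cast (hx μ).1
  · rw [relC, div_le_iff₀ hTpos]; exact_mod_cast (hx μ).2

/-- the constants of the bump: `c₁θ = sup|θ′|`. [cite: Balaban1983Higgs3, p.420] -/
def c1Theta : ℝ := D1 prof3

/-- the constants of the bump: `c₂θ(d) = d(sup|θ″| + sup|θ′|²)`. [cite: Balaban1983Higgs3, p.420] -/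
def c2Theta (d : ℕ) : ℝ := (d : ℝ) * (D2 prof3 + D1 prof3 ^ 2)

/-- **THE EXTERNAL-FIELD BUMP IS A SMOOTH LOCALIZATION FUNCTION** supported (with collar) in the periodic side-3 box at its corner, for every
`k` with `4 ≤ L^k` and `3L^k ≤ |T_ε|_μ`. [cite: Balaban1983Higgs3, p.420] -/
theorem isSmoothLoc_theta (hT : 4 ≤ P.L ^ k) (h3 : ∀ μ, 3 * P.L ^ k ≤ P.sitesPerDir 0 μ) (c : HiggsLattice.Site P 0) :
    IsSmoothLoc k c1Theta (c2Theta P.d) 1 (pboxSet k c 3) (theta k c) :=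
  isSmoothLoc_bump isProfile_prof3 hT h3 c

/-- … in p40's box form, for a cube-aligned corner whose box does not wrap: support `boxSet k (c/L^k) 3` = the `3^d` unit cubes around `□(v)`.
[cite: Balaban1983Higgs3, p.420] -/
theorem isSmoothLoc_theta_boxSet (hT : 4 ≤ P.L ^ k) (h3 : ∀ μ, 3 * P.L ^ k ≤ P.sitesPerDir 0 μ) {c : HiggsLattice.Site P 0}
    (hc : ∀ μ, P.L ^ k ∣ (c μ).val) (hfit : ∀ μ, (c μ).val + 3 * P.L ^ k ≤ P.sitesPerDir 0 μ) :
    IsSmoothLoc k c1Theta (c2Theta P.d) 1 (boxSet k (fun μ => (c μ).val / P.L ^ k) 3) (theta k c) := by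
  rw [← pboxSet_eq_boxSet hc hfit]; exact isSmoothLoc_theta hT h3 c

/-- … and at every Hölder exponent `0 ≤ α ≤ 1` (constant `c₂θ + 2c₁θ`). [cite: Balaban1983Higgs3, p.420] -/
theorem isSmoothLoc_theta_rpow (hT : 4 ≤ P.L ^ k) (h3 : ∀ μ, 3 * P.L ^ k ≤ P.sitesPerDir 0 μ) (c : HiggsLattice.Site P 0)
    {α : ℝ} (hα0 : 0 ≤ α) (hα1 : α ≤ 1) :
    IsSmoothLoc k c1Theta (c2Theta P.d + 2 * c1Theta) α (pboxSet k c 3) (theta k c) :=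
  isSmoothLoc_bump_rpow isProfile_prof3 hT h3 c hα0 hα1

/-! ### (b) the vector-leg smooth partition of unity with supports in cubes of side 2 -/

/-- **the partition member with corner `c`**: `χ_c(x) = ∏_μ χ((x_μ − c_μ).val/L^k)`. [cite: Balaban1983Higgs3, p.420] -/
def chi (k : ℕ) (c : HiggsLattice.Site P 0) : HiggsLattice.Site P 0 → ℝ := bump prof2 k c

/-- **the cube-aligned corners**: sites all of whose labels are multiples of `L^k` (one per unit cube of the `η`-lattice).
[cite: Balaban1983Higgs3, p.420] [cite: Balaban1982Higgs1, (1.20) p.607] -/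
def corners (k : ℕ) : Finset (HiggsLattice.Site P 0) :=
  Fintype.piFinset fun μ => Finset.univ.filter fun a : ZMod (P.sitesPerDir 0 μ) => P.L ^ k ∣ a.val

/-- membership in `corners`. [cite: Balaban1983Higgs3, p.420] -/
theorem mem_corners {c : HiggsLattice.Site P 0} : c ∈ corners k ↔ ∀ μ, P.L ^ k ∣ (c μ).val := by
  have h : c ∈ corners k ↔ ∀ μ, c μ ∈ (Finset.univ.filter fun a : ZMod (P.sitesPerDir 0 μ) => P.L ^ k ∣ a.val) :=
    Fintype.mem_piFinset
  rw [h]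
  exact forall_congr' fun μ => by simp

/-- `0 ≤ χ_c ≤ 1`. [cite: Balaban1983Higgs3, p.420] -/
theorem chi_mem_Icc (c x : HiggsLattice.Site P 0) : chi k c x ∈ Set.Icc (0 : ℝ) 1 := by
  unfold chi bump
  exact ⟨Finset.prod_nonneg fun μ _ => prof2_nonneg _, Finset.prod_le_one (fun μ _ => prof2_nonneg _) fun μ _ => prof2_le_one _⟩

/-- the constants of the partition members: `c₁χ = sup|χ′|`. [cite: Balaban1983Higgs3, p.420] -/
def c1Chi : ℝ := D1 prof2

/-- the constants of the partition members: `c₂χ(d) = d(sup|χ″| + sup|χ′|²)`. [cite: Balaban1983Higgs3, p.420] -/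
def c2Chi (d : ℕ) : ℝ := (d : ℝ) * (D2 prof2 + D1 prof2 ^ 2)

/-- **EVERY PARTITION MEMBER IS A SMOOTH LOCALIZATION FUNCTION** supported (with collar) in the periodic side-2 box at its corner («a support of
each function is contained in a cube with sides of length 2»), for every `k ≤ K` with `4 ≤ L^k`. [cite: Balaban1983Higgs3, p.420] -/
theorem isSmoothLoc_chi (hT : 4 ≤ P.L ^ k) (hk : k ≤ P.K) (c : HiggsLattice.Site P 0) :
    IsSmoothLoc k c1Chi (c2Chi P.d) 1 (pboxSet k c 2) (chi k c) :=
  isSmoothLoc_bump isProfile_prof2 hT (two_mul_pow_le_sitesPerDir hk) c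

/-- … in p40's box form `boxSet k (c/L^k) 2`, for an aligned corner whose box does not wrap. [cite: Balaban1983Higgs3, p.420] -/
theorem isSmoothLoc_chi_boxSet (hT : 4 ≤ P.L ^ k) (hk : k ≤ P.K) {c : HiggsLattice.Site P 0} (hc : c ∈ corners k)
    (hfit : ∀ μ, (c μ).val + 2 * P.L ^ k ≤ P.sitesPerDir 0 μ) :
    IsSmoothLoc k c1Chi (c2Chi P.d) 1 (boxSet k (fun μ => (c μ).val / P.L ^ k) 2) (chi k c) := by
  rw [← pboxSet_eq_boxSet (mem_corners.1 hc) hfit]; exact isSmoothLoc_chi hT hk c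

/-- … and at every Hölder exponent `0 ≤ α ≤ 1` (constant `c₂χ + 2c₁χ`). [cite: Balaban1983Higgs3, p.420] -/
theorem isSmoothLoc_chi_rpow (hT : 4 ≤ P.L ^ k) (hk : k ≤ P.K) (c : HiggsLattice.Site P 0) {α : ℝ} (hα0 : 0 ≤ α) (hα1 : α ≤ 1) :
    IsSmoothLoc k c1Chi (c2Chi P.d + 2 * c1Chi) α (pboxSet k c 2) (chi k c) :=
  isSmoothLoc_bump_rpow isProfile_prof2 hT (two_mul_pow_le_sitesPerDir hk) c hα0 hα1

/-- **the one-variable periodic partition identity**: on the circle `ZMod n` with `n = NT`, `N ≥ 2`, for every label `w`,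
`Σ_{a : T ∣ a} χ((w − a).val/T) = 1` — the `N` translates of the side-2 profile by whole unit cubes sum to one (from `Σ_{n∈ℤ} hprof(t−n)² = 1`,
the members across the seam included). [cite: Balaban1983Higgs3, p.420] [cite: Balaban1983RegularityDecay, §2 p.575] -/
theorem sum_prof2_periodic {n T : ℕ} [NeZero n] (hT : 0 < T) (hTn : T ∣ n) (h2 : 2 * T ≤ n) (w : ZMod n) :
    ∑ a ∈ Finset.univ.filter (fun a : ZMod n => T ∣ a.val), prof2 (((w - a).val : ℝ) / T) = 1 := by
  obtain ⟨N, hN⟩ := hTn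
  have hN2 : 2 ≤ N := by
    by_contra h
    have : T * N ≤ T * 1 := Nat.mul_le_mul_left T (by omega)
    rw [mul_one] at this
    omega
  -- the aligned labels are `jT`, `j < N`
  set e : ℕ → ZMod n := fun j => ((j * T : ℕ) : ZMod n) with he
  have hval : ∀ j, j < N → (e j).val = j * T := by
    intro j hj
    apply ZMod.val_cast_of_lt
    rw [hN]
    nlinarith
  have hinj : Set.InjOn e ↑(Finset.range N) := by
    intro j₁ hj₁ j₂ hj₂ h
    have h' := congrArg ZMod.val h
    rw [hval j₁ (Finset.mem_range.1 hj₁), hval j₂ (Finset.mem_range.1 hj₂)] at h'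
    exact Nat.eq_of_mul_eq_mul_right hT h'
  have himg : (Finset.range N).image e = Finset.univ.filter (fun a : ZMod n => T ∣ a.val) := by
    ext a
    simp only [Finset.mem_image, Finset.mem_range, Finset.mem_filter, Finset.mem_univ, true_and]
    constructor
    · rintro ⟨j, hj, rfl⟩; rw [hval j hj]; exact Dvd.intro_left j rfl
    · rintro ⟨q, hq⟩
      refine ⟨q, ?_, ?_⟩
      · have := ZMod.val_lt a; rw [hq, hN] at this; exact Nat.lt_of_mul_lt_mul_left this
      · show ((q * T : ℕ) : ZMod n) = a
        rw [mul_comm, ← hq, ZMod.natCast_zmod_val]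
  rw [← himg, Finset.sum_image hinj]
  -- the real coordinate `u = w.val/T ∈ [0, N)`
  set v : ℕ := w.val with hv
  have hvn : v < T * N := by rw [← hN]; exact ZMod.val_lt w
  have hTr : (0 : ℝ) < T := by exact_mod_cast hT
  set u : ℝ := (v : ℝ) / T with hu
  have huT : u * T = v := by rw [hu]; field_simp
  have hu0 : 0 ≤ u := div_nonneg (Nat.cast_nonneg _) hTr.le
  have huN : u < N := by
    rw [hu, div_lt_iff₀ hTr]
    have : (v : ℝ) < (T : ℝ) * N := by exact_mod_cast hvn
    linarith
  -- the integer label of the `j`-th translate as seen from `u`: `j` or `j − N`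
  set σ : ℕ → ℤ := fun j => (j : ℤ) - if v < j * T then (N : ℤ) else 0 with hσ
  have hcoord : ∀ j, j < N → (((w - e j).val : ℕ) : ℝ) / T = u - (σ j : ℝ) := by
    intro j hj
    have hej := hval j hj
    by_cases hlt : v < j * T
    · have hle : w.val ≤ (e j).val := by rw [hej]; exact hlt.le
      have hsub : (e j - w).val = j * T - v := by rw [ZMod.val_sub hle, hej]
      have hne : e j - w ≠ 0 := by
        intro h0; have := congrArg ZMod.val h0; rw [hsub, ZMod.val_zero] at this; omega
      have hval' : (w - e j).val = n - (j * T - v) := by rw [← neg_sub, ZMod.neg_val, if_neg hne, hsub]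
      rw [hval', hσ]
      simp only [if_pos hlt]
      have hjT : j * T ≤ T * N := by nlinarith
      rw [Nat.cast_sub (by rw [hN]; omega), Nat.cast_sub hlt.le, hN]
      push_cast
      rw [hu]
      field_simp
      ring
    · have hle : (e j).val ≤ w.val := by rw [hej]; exact not_lt.1 hlt
      rw [ZMod.val_sub hle, hej, hσ]
      simp only [if_neg hlt]
      rw [Nat.cast_sub (not_lt.1 hlt)]
      push_cast
      rw [hu]
      field_simp
      ring
  have hterm : ∀ j ∈ Finset.range N, prof2 ((((w - e j).val : ℕ) : ℝ) / T) = hprof ((u - 1) - (σ j : ℝ)) ^ 2 := by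
    intro j hj
    rw [hcoord j (Finset.mem_range.1 hj), prof2, show u - (σ j : ℝ) - 1 = u - 1 - (σ j : ℝ) by ring]
  have hσinj : Set.InjOn σ ↑(Finset.range N) := by
    intro j₁ hj₁ j₂ hj₂ h
    have h1 := Finset.mem_range.1 hj₁
    have h2 := Finset.mem_range.1 hj₂
    simp only [hσ] at h
    split_ifs at h <;> omega
  have hcover : ∀ i : ℤ, hprof ((u - 1) - i) ≠ 0 → i ∈ (Finset.range N).image σ := by
    intro i hi
    have habs : |(u - 1) - i| < 5 / 8 := by by_contra hc; exact hi (hprof_eq_zero (not_lt.1 hc))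
    rw [abs_lt] at habs
    obtain ⟨hlo, hhi⟩ := habs
    rw [Finset.mem_image]
    by_cases hi0 : 0 ≤ i
    · obtain ⟨j, rfl⟩ := Int.eq_ofNat_of_zero_le hi0
      have hjR : ((j : ℤ) : ℝ) = (j : ℝ) := by norm_cast
      rw [hjR] at hlo hhi
      have hjN : j < N := by
        have : (j : ℝ) < N := by linarith
        exact_mod_cast this
      have hjv : ¬ v < j * T := by
        intro hlt'
        have h' : (v : ℝ) < (j : ℝ) * T := by exact_mod_cast hlt'
        have hju : (j : ℝ) < u := by linarith
        nlinarith
      refine ⟨j, Finset.mem_range.2 hjN, ?_⟩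
      rw [hσ]; simp only [if_neg hjv, sub_zero]
    · have hi1 : i = -1 := by
        have : (-2 : ℝ) < i := by linarith
        have h' : (-2 : ℤ) < i := by exact_mod_cast this
        omega
      subst hi1
      refine ⟨N - 1, Finset.mem_range.2 (by omega), ?_⟩
      have hu58 : u < 5 / 8 := by push_cast at hhi; linarith
      have hlt' : v < (N - 1) * T := by
        have hN1 : (1 : ℝ) ≤ ((N - 1 : ℕ) : ℝ) := by
          have : 1 ≤ N - 1 := by omega
          exact_mod_cast this
        have : (v : ℝ) < ((N - 1 : ℕ) : ℝ) * T := by nlinarith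
        exact_mod_cast this
      rw [hσ]; simp only [if_pos hlt']
      rw [Nat.cast_sub (by omega : 1 ≤ N)]
      push_cast
      ring
  rw [Finset.sum_congr rfl hterm, ← Finset.sum_image (f := fun i : ℤ => hprof ((u - 1) - i) ^ 2) hσinj]
  exact sum_hprof_sq _ hcover

/-- **THE PARTITION OF UNITY**: at every site of `T_ε`, `Σ_{c ∈ corners k} χ_c(x) = 1` (`k ≤ K`; the members whose box straddles the
coordinate seam are included — the torus has no seam). [cite: Balaban1983Higgs3, p.420] -/
theorem sum_chi (hk : k ≤ P.K) (x : HiggsLattice.Site P 0) : ∑ c ∈ corners k, chi k c x = 1 := by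
  have hT : 0 < P.L ^ k := pow_pos P.hL k
  have e : ∑ c ∈ corners k, chi k c x = ∏ μ, ∑ a ∈ (Finset.univ.filter fun a : ZMod (P.sitesPerDir 0 μ) => P.L ^ k ∣ a.val),
      prof2 ((((x μ - a).val : ℕ) : ℝ) / (P.L : ℝ) ^ k) := by
    unfold corners chi bump relC
    exact (Finset.prod_univ_sum (fun μ => Finset.univ.filter fun a : ZMod (P.sitesPerDir 0 μ) => P.L ^ k ∣ a.val)
      (fun μ a => prof2 ((((x μ - a).val : ℕ) : ℝ) / (P.L : ℝ) ^ k))).symm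
  rw [e]
  refine Finset.prod_eq_one fun μ _ => ?_
  have h := sum_prof2_periodic (n := P.sitesPerDir 0 μ) hT (pow_dvd_sitesPerDir hk μ) (two_mul_pow_le_sitesPerDir hk μ) (x μ)
  push_cast at h
  exact h

/-! ### (c) inhabitants of the carrier `SmoothLocFn` of `…B3Ineq25SmoothLocalization` -/

/-- **a genuine element of p33 g61's `SmoothLocFn`**: the product bump of any side-`m` profile on a box of admissible unit cubes (interior points
of `Ω₂` at margin `≥ r₀L^k`) — e.g. `θ_c` with `m = 3`, `χ_c` with `m = 2`. [cite: Balaban1983Higgs3, p.420] [cite: Balaban1983Higgs3, (2.5) p.424] -/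
def smoothLocFnOfBump {m : ℕ} {g : ℝ → ℝ} (hg : IsProfile m g) (hT : 4 ≤ P.L ^ k) (hm : ∀ μ, m * P.L ^ k ≤ P.sitesPerDir 0 μ)
    {K₀ r₀ : ℕ} {Ω₂ : Finset (HiggsLattice.Site P 0)} {c : HiggsLattice.Site P 0} (hc : ∀ μ, P.L ^ k ∣ (c μ).val)
    (hfit : ∀ μ, (c μ).val + m * P.L ^ k ≤ P.sitesPerDir 0 μ) (hn : ∀ μ, 2 * (m * P.L ^ k) ≤ P.sitesPerDir 0 μ)
    (hS : ∀ x, InBox k (fun μ => (c μ).val / P.L ^ k) m x → Interior k K₀ Ω₂ x ∧ (r₀ : ℝ) * (P.L : ℝ) ^ k ≤ distC Ω₂ x) :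
    SmoothLocFn k K₀ Ω₂ r₀ m (D1 g) ((P.d : ℝ) * (D2 g + D1 g ^ 2)) :=
  SmoothLocFn.ofBox (fun μ => (c μ).val / P.L ^ k) hn hS (by rw [← pboxSet_eq_boxSet hc hfit]; exact isSmoothLoc_bump hg hT hm c)

/-- its localization function IS the bump. [cite: Balaban1983Higgs3, p.420] -/
theorem smoothLocFnOfBump_fn {m : ℕ} {g : ℝ → ℝ} (hg : IsProfile m g) (hT : 4 ≤ P.L ^ k) (hm : ∀ μ, m * P.L ^ k ≤ P.sitesPerDir 0 μ)
    {K₀ r₀ : ℕ} {Ω₂ : Finset (HiggsLattice.Site P 0)} {c : HiggsLattice.Site P 0} (hc : ∀ μ, P.L ^ k ∣ (c μ).val)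
    (hfit : ∀ μ, (c μ).val + m * P.L ^ k ≤ P.sitesPerDir 0 μ) (hn : ∀ μ, 2 * (m * P.L ^ k) ≤ P.sitesPerDir 0 μ)
    (hS : ∀ x, InBox k (fun μ => (c μ).val / P.L ^ k) m x → Interior k K₀ Ω₂ x ∧ (r₀ : ℝ) * (P.L : ℝ) ^ k ≤ distC Ω₂ x) :
    (smoothLocFnOfBump hg hT hm hc hfit hn hS).fn = bump g k c := rfl

/-- the bump is not the zero function: it equals `1` at the site `c + L^k𝟙` of the middle cube (so the class `IsSmoothLoc`, and with it the
smooth members of rows B3.Eq3.1 / B3.Eq2.5, are NOT only about `h = 0`). [cite: Balaban1983Higgs3, p.420] -/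
theorem theta_corner_shift_eq_one (c : HiggsLattice.Site P 0) (h3 : ∀ μ, 3 * P.L ^ k ≤ P.sitesPerDir 0 μ) :
    theta k c (fun μ => c μ + ((P.L ^ k : ℕ) : ZMod (P.sitesPerDir 0 μ))) = 1 := by
  refine theta_eq_one fun μ => ?_
  have hlt : P.L ^ k < P.sitesPerDir 0 μ := by have := h3 μ; have := pow_pos P.hL k; omega
  have e : (fun ν => c ν + ((P.L ^ k : ℕ) : ZMod (P.sitesPerDir 0 ν))) μ - c μ = ((P.L ^ k : ℕ) : ZMod (P.sitesPerDir 0 μ)) := by ring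
  rw [e, ZMod.val_cast_of_lt hlt]
  have := pow_pos P.hL k
  omega

end P420

end Literature.MathematicalPhysics.QuantumFieldTheory.Balaban1983to89.B3SmoothLocalization420
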